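import Summits.CriticalPhenomena.CardyFormulaZ2.Theorems.CardyComplexConeEdgePrecompactUFRSMarkedDecayRectLocal
import Summits.CriticalPhenomena.CardyFormulaZ2.Theorems.CardyComplexConeEdgePrecompactUFRSRectBoundaryStrandDecayCases

/-!
# UFRS on rectangles: the junction two-strand decay HJ from a per-scale bound
(line `qkz-strip-boundary-arm` of crux `CardyComplexCone.EdgePrecompact`, stmt-CriticalPhenomena-11387;
support for the registered bridge `ufrs_rect_junctionTwoStrandDecay` = hypothesis HJ of
`ufrs_markedPointDecay_rect_of_bridges`, lead c5, wave 2)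

## What is proved here

`ufrs_rect_junctionTwoStrandDecay_of_scale` (registered sub-goal): the multi-scale ASSEMBLY of the
bridge HJ — "for an open axis-parallel rectangle `D` there are `C, β > 0` (depending on `D` only)
such that for `η < η₀`, `E.δ < δ₀(η)`, every admissible datum `E` of `D`, shift `‖E.δ w‖ < η`,
marked edge `e₀` of `E` or of `shiftData E w`, and `η ≤ s`, `0 < S`:
`P_{1/2}(ufrsStrands E w (medialPoint E.δ e₀) 2 s S) ≤ C (s/S)^β`" (VERBATIM the registered
signature of `ufrs_rect_junctionTwoStrandDecay`) — from the PER-SCALE bound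
`ufrs_junction_scale_le` (registered sub-goal, the hypothesis, stated inline):

> (HJ-S) there are `c > 0`, an aspect ratio `K ≥ 2`, `M ≥ 1`, `R₀ > 0` and `N₀ : ℕ` (depending on
> `D`) such that for `η < η₀`, `E.δ < δ₀(η)`, data as above, one can name at most `N₀` exceptional
> scale windows `(x/K, Kx)` (`x ∈ X`, a finite set depending on `E, w, e₀`: the distance to the
> second junction, to the corners of `D`, …) outside of which, for `Mη ≤ r`, `K r ≤ R₀`,
> `P_{1/2}(ufrsStrands E w m 2 r (K r)) ≤ 1 - c` (`m = medialPoint E.δ e₀`).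

Why the windows: in HJ the arcs of `E` are ARBITRARY admissible arcs of the rectangle (only
`E.Ω = D.carrier` is imposed), so the second junction of `E` may sit at any distance from `m`;
uniformly in `E`, a per-scale bound must be allowed to skip boundedly many scales (a window of
ratio `K²` kills at most one scale of the ratio-`2K²` progression used here).

## Proof

With `q = 1 - min c ½ ∈ [½, 1)`, `L = 2K²` and `β = log_L (1/q)` (so `q L^β = 1`):
* `ufrsStrands_eq_empty_of_far_HJ`: for `S > (x₁-x₀)+(y₁-y₀)+2η` the event is EMPTY — every corner
  of an inner face of `E` lies in `D`, of `shiftData E w` in `D + E.δ w`, and so do the endpoints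
  of the marked edges (`ufrsStrands_eq_empty_of_far`, `discreteDomainGraph_adj_iff`);
* otherwise `S' := min S R₀ ≥ θ S` with `θ = min 1 (R₀/((x₁-x₀)+(y₁-y₀)+1))`, and by induction on
  the number `n` of scales, for every inner radius `t ≥ Mη` and every finite set `Y` containing the
  centres of the windows met by the scales `L^k t` (`k < n`), if `S' ≤ L^n K t` then
  `P(ufrsStrands E w m 2 t S) ≤ q^{-|Y|} (K t/S')^β`: at a GOOD first scale split off the annulus
  `A(m; t, Kt)` — `ufrsStrands … t S ⊆ ufrsStrands … t (Kt) ∩ ufrsStrands … (Lt) S`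
  (`ufrsStrands_mono_radii`), the two factors being independent (`real_inter_ufrsStrands_W3M`,
  the edge annuli `[t-2δ, Kt+2δ]`, `[Lt-2δ, S+2δ]` are disjoint) — and use `q · L^β = 1`; at a BAD
  first scale drop it and erase its window centre from `Y` (it cannot serve again: `L > K²`);
* finally `t = M s`, `Y = X`, `|X| ≤ N₀`: `P ≤ q^{-N₀} (K M s/S')^β ≤ q^{-N₀} (K M/θ)^β (s/S)^β`.

References: G. Grimmett, *Percolation* (1999), §11.7 ((11.72), multi-scale independence);
H. Kesten, Comm. Math. Phys. 109 (1987), §2; S. Smirnov, C. R. Acad. Sci. Paris 333 (2001), §2.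
-/

namespace Summit.CriticalPhenomena.CardyFormulaZ2.Cruxes.EdgePrecompact.QkzStripBoundaryArm

open MeasureTheory Filter Set Metric
open scoped Topology BigOperators Pointwise
open Literature.Probability.LatticeModels Literature.Probability.Percolation
open Literature.Probability.RandomPlanarGeometry (DobrushinDomain)
open Summit.CriticalPhenomena.CardyFormulaZ2.Theses.CardyComplexCone

noncomputable section

/-! ## Geometry: marked midpoints stay within a bounded distance of the two domains -/

/-- Two points each within `η` of a point of the rectangle are within `(x₁-x₀)+(y₁-y₀)+2η`
(`dist_le_of_mem_rect`). -/
theorem dist_le_of_near_rect_HJ {x₀ x₁ y₀ y₁ η : ℝ} {p q p' q' : ℂ}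
    (hp' : p' ∈ Set.Ioo x₀ x₁ ×ℂ Set.Ioo y₀ y₁) (hq' : q' ∈ Set.Ioo x₀ x₁ ×ℂ Set.Ioo y₀ y₁)
    (hp : dist p p' ≤ η) (hq : dist q q' ≤ η) :
    dist p q ≤ (x₁ - x₀) + (y₁ - y₀) + 2 * η := by
  rw [dist_comm q q'] at hq
  linarith [dist_le_of_mem_rect hp' hq', dist_triangle p p' q, dist_triangle p' q' q]

/-- The midpoint inequality in `ℂ`: `dist x ((p+q)/2) ≤ (dist x p + dist x q)/2`. -/
theorem dist_midpoint_le_HJ (x p q : ℂ) : dist x ((p + q) / 2) ≤ (dist x p + dist x q) / 2 := by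
  simp only [dist_eq_norm]
  have h : x - (p + q) / 2 = ((x - p) + (x - q)) / 2 := by ring
  rw [h, norm_div, Complex.norm_two]
  exact div_le_div_of_nonneg_right (norm_add_le _ _) (by norm_num)

/-- A bound at both endpoints of a pair of sites bounds the distance to its medial point. -/
theorem dist_medialPoint_le_HJ {δ : ℝ} {x : ℂ} {B : ℝ} (e : Sym2 (Site 2))
    (h : ∀ a ∈ e, dist x (meshPoint δ a) ≤ B) : dist x (medialPoint δ e) ≤ B := by
  induction e using Sym2.ind with
  | h a b =>
    rw [medialPoint_mk]
    linarith [h a (Sym2.mem_mk_left a b), h b (Sym2.mem_mk_right a b),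
      dist_midpoint_le_HJ x (meshPoint δ a) (meshPoint δ b)]

/-- The endpoints of an `A`–`B` edge of a Dobrushin datum are sites of its domain. -/
theorem meshPoint_mem_of_mem_zdABEdges_HJ (Dd : DiscreteDobrushin) {e : Sym2 (Site 2)}
    (he : e ∈ Dd.zdABEdges) : ∀ a ∈ e, meshPoint Dd.δ a ∈ Dd.Ω := by
  intro a ha
  rw [DiscreteDobrushin.mem_zdABEdges_iff] at he
  obtain ⟨hedge, -, -⟩ := he
  induction e using Sym2.ind with
  | h x y =>
    rw [SimpleGraph.mem_edgeSet, discreteDomainGraph_adj_iff] at hedge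
    rcases Sym2.mem_iff.1 ha with rfl | rfl
    · exact meshDomain_subset_meshVertices _ _ hedge.2.1
    · exact meshDomain_subset_meshVertices _ _ hedge.2.2

/-- A point of `E.Ω` (the rectangle) or of `(shiftData E w).Ω` (`‖E.δ w‖ ≤ η`) is within `η` of a
point of the rectangle. -/
theorem exists_near_of_mem_HJ {x₀ x₁ y₀ y₁ η : ℝ} {E : DiscreteDobrushin} {w : Site 2}
    (hEΩ : E.Ω = Set.Ioo x₀ x₁ ×ℂ Set.Ioo y₀ y₁) (hη : 0 ≤ η) (hw : ‖meshPoint E.δ w‖ ≤ η) {p : ℂ}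
    (hp : p ∈ E.Ω ∨ p ∈ (shiftData E w).Ω) :
    ∃ p' ∈ Set.Ioo x₀ x₁ ×ℂ Set.Ioo y₀ y₁, dist p p' ≤ η := by
  rcases hp with h | h
  · exact ⟨p, by rw [← hEΩ]; exact h, by rw [dist_self]; exact hη⟩
  · rw [shiftData_Ω, Set.mem_vadd_set] at h
    obtain ⟨y, hy, hyp⟩ := h
    refine ⟨y, by rw [← hEΩ]; exact hy, ?_⟩
    rw [← hyp, vadd_eq_add, dist_eq_norm, add_sub_cancel_right]
    exact hw

/-- **Far strands do not exist.** If `E.Ω` is the rectangle `(x₀,x₁) × (y₀,y₁)`, `‖E.δ w‖ ≤ η`,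
`e₀` is a marked edge of `E` or of `shiftData E w` and `S > (x₁-x₀)+(y₁-y₀)+2η`, the event
`ufrsStrands E w (medialPoint E.δ e₀) k s S` (`k ≥ 1`) is empty: by `ufrsStrands_eq_empty_of_far`,
since every point of either domain (and each endpoint of `e₀`) is within `η` of the rectangle. -/
theorem ufrsStrands_eq_empty_of_far_HJ {x₀ x₁ y₀ y₁ η : ℝ} {E : DiscreteDobrushin} {w : Site 2}
    (hEΩ : E.Ω = Set.Ioo x₀ x₁ ×ℂ Set.Ioo y₀ y₁) (hη : 0 ≤ η) (hw : ‖meshPoint E.δ w‖ ≤ η)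
    {e₀ : Sym2 (Site 2)} (he₀ : e₀ ∈ E.zdABEdges ∨ e₀ ∈ (shiftData E w).zdABEdges)
    {k : ℕ} (hk : 0 < k) (s : ℝ) {S : ℝ} (hS : (x₁ - x₀) + (y₁ - y₀) + 2 * η < S) :
    ufrsStrands E w (medialPoint E.δ e₀) k s S = ∅ := by
  -- every point of either domain is close to the marked midpoint
  have hclose : ∀ p : ℂ, (p ∈ E.Ω ∨ p ∈ (shiftData E w).Ω) →
      dist p (medialPoint E.δ e₀) ≤ (x₁ - x₀) + (y₁ - y₀) + 2 * η := by
    intro p hp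
    obtain ⟨p', hp', hpp'⟩ := exists_near_of_mem_HJ hEΩ hη hw hp
    refine dist_medialPoint_le_HJ e₀ fun a ha => ?_
    have ha' : meshPoint E.δ a ∈ E.Ω ∨ meshPoint E.δ a ∈ (shiftData E w).Ω :=
      he₀.imp (fun h => meshPoint_mem_of_mem_zdABEdges_HJ E h a ha)
        (fun h => meshPoint_mem_of_mem_zdABEdges_HJ (shiftData E w) h a ha)
    obtain ⟨q', hq', haq'⟩ := exists_near_of_mem_HJ hEΩ hη hw ha'
    exact dist_le_of_near_rect_HJ hp' hq' hpp' haq'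
  exact ufrsStrands_eq_empty_of_far hk (fun p hp => (hclose p (Or.inl hp)).trans_lt hS)
    (fun p hp => (hclose p (Or.inr hp)).trans_lt hS)

/-! ## The scale induction -/

/-- **The scale induction.** Fix the data, the centre `m`, an aspect ratio `K`, a scale ratio
`L > K²` with `L ≥ K + 4`, `q ∈ (0, 1]` with `L^β = 1/q`, an effective outer radius
`S' ≤ min S R₀`, and the per-scale bound `P(ufrsStrands E w m 2 r (K r)) ≤ q` for `Mη ≤ r ≤ R₀/K`
outside the windows `(x/K, Kx)`, `x ∈ X`. Then for every `n`, every inner radius `t ≥ Mη > E.δ`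
and every finite set `Y` containing the centres of the windows met by the scales `L^k t`, `k < n`:
if `S' ≤ L^n K t` then `P(ufrsStrands E w m 2 t S) ≤ q^{-|Y|} (K t/S')^β`. At a good first scale
split off `A(m; t, Kt)` (independence `real_inter_ufrsStrands_W3M`, monotonicity
`ufrsStrands_mono_radii`, `q L^β = 1`); at a bad one drop it and erase its centre from `Y`. -/
theorem junction_scalesInduction_HJ {E : DiscreteDobrushin} {w : Site 2} (hδ : 0 < E.δ) {m : ℂ}
    {K L q β S S' R₀ M η : ℝ} {X : Finset ℝ}
    (hK0 : 0 < K) (hLK : K ^ 2 < L) (hLK' : K + 4 ≤ L) (hq0 : 0 < q) (hq1 : 1 ≤ 1 / q)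
    (hLβ : L ^ β = 1 / q) (hβ0 : 0 ≤ β) (hS'0 : 0 < S') (hS'S : S' ≤ S) (hS'R : S' ≤ R₀)
    (hMη : 0 < M * η) (hδη : E.δ < M * η)
    (hgood : ∀ r : ℝ, M * η ≤ r → K * r ≤ R₀ → (∀ x ∈ X, r ≤ x / K ∨ K * x ≤ r) →
      (bondPercolation (zdGraph 2) half).real (ufrsStrands E w m 2 r (K * r)) ≤ q) :
    ∀ (n : ℕ) (t : ℝ) (Y : Finset ℝ), M * η ≤ t →
      (∀ k < n, ∀ x ∈ X, x / K < L ^ k * t → L ^ k * t < K * x → x ∈ Y) →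
      S' ≤ L ^ n * (K * t) →
      (bondPercolation (zdGraph 2) half).real (ufrsStrands E w m 2 t S) ≤
        (1 / q) ^ Y.card * (K * t / S') ^ β := by
  have hL1 : 1 ≤ L := by linarith
  have hL0 : 0 < L := by linarith
  have hqL : q * L ^ β = 1 := by rw [hLβ]; field_simp
  have hLk : ∀ (k : ℕ) (t : ℝ), L ^ (k + 1) * t = L ^ k * (L * t) := fun k t => by
    rw [pow_succ]; ring
  intro n
  induction n with
  | zero =>
    intro t Y ht hY hn
    rw [pow_zero, one_mul] at hn
    have ht0 : 0 < t := lt_of_lt_of_le hMη ht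
    have h1 : 1 ≤ K * t / S' := by rw [le_div_iff₀ hS'0]; linarith
    have h4 : (bondPercolation (zdGraph 2) half).real (ufrsStrands E w m 2 t S) ≤ 1 :=
      measureReal_le_one
    calc (bondPercolation (zdGraph 2) half).real (ufrsStrands E w m 2 t S) ≤ 1 * 1 := by linarith
      _ ≤ (1 / q) ^ Y.card * (K * t / S') ^ β :=
          mul_le_mul (one_le_pow₀ hq1) (Real.one_le_rpow h1 hβ0) zero_le_one (by positivity)
  | succ n ih =>
    intro t Y ht hY hn
    have ht0 : 0 < t := lt_of_lt_of_le hMη ht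
    by_cases hsmall : S' ≤ L ^ n * (K * t)
    · exact ih t Y ht (fun k hk => hY k (Nat.lt_succ_of_lt hk)) hsmall
    rw [not_le] at hsmall
    -- the next inner radius `L t`
    have htL : t ≤ L * t := le_mul_of_one_le_left ht0.le hL1
    have hLt : M * η ≤ L * t := ht.trans htL
    have hn' : S' ≤ L ^ n * (K * (L * t)) := by
      calc S' ≤ L ^ (n + 1) * (K * t) := hn
        _ = L ^ n * (K * (L * t)) := by rw [pow_succ]; ring
    have hKt : K * t < S' :=
      lt_of_le_of_lt (le_mul_of_one_le_left (by positivity) (one_le_pow₀ hL1)) hsmall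
    have hpow : (K * (L * t) / S') ^ β = L ^ β * (K * t / S') ^ β := by
      rw [show K * (L * t) / S' = L * (K * t / S') by ring]
      exact Real.mul_rpow hL0.le (by positivity)
    by_cases hbad : ∀ x ∈ X, t ≤ x / K ∨ K * x ≤ t
    · -- GOOD first scale: split off the annulus `A(m; t, Kt)`
      have hY' : ∀ k < n, ∀ x ∈ X, x / K < L ^ k * (L * t) → L ^ k * (L * t) < K * x → x ∈ Y := by
        intro k hk x hxX h1 h2
        rw [← hLk] at h1 h2
        exact hY (k + 1) (by omega) x hxX h1 h2
      have hih := ih (L * t) Y hLt hY' hn'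
      have hmono : ufrsStrands E w m 2 t S ⊆
          ufrsStrands E w m 2 t (K * t) ∩ ufrsStrands E w m 2 (L * t) S :=
        Set.subset_inter (ufrsStrands_mono_radii le_rfl (by linarith)) (ufrsStrands_mono_radii htL le_rfl)
      have hind : (bondPercolation (zdGraph 2) half).real
            (ufrsStrands E w m 2 t (K * t) ∩ ufrsStrands E w m 2 (L * t) S) =
          (bondPercolation (zdGraph 2) half).real (ufrsStrands E w m 2 t (K * t)) *
            (bondPercolation (zdGraph 2) half).real (ufrsStrands E w m 2 (L * t) S) := by
        refine real_inter_ufrsStrands_W3M E w hδ fun x _ h2 h3 _ => ?_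
        have hδt : E.δ < t := lt_of_lt_of_le hδη ht
        nlinarith
      have h1 : (bondPercolation (zdGraph 2) half).real (ufrsStrands E w m 2 t (K * t)) ≤ q :=
        hgood t ht (by linarith) hbad
      calc (bondPercolation (zdGraph 2) half).real (ufrsStrands E w m 2 t S)
          ≤ (bondPercolation (zdGraph 2) half).real
              (ufrsStrands E w m 2 t (K * t) ∩ ufrsStrands E w m 2 (L * t) S) :=
            measureReal_mono hmono (measure_ne_top _ _)
        _ = (bondPercolation (zdGraph 2) half).real (ufrsStrands E w m 2 t (K * t)) *
              (bondPercolation (zdGraph 2) half).real (ufrsStrands E w m 2 (L * t) S) := hind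
        _ ≤ q * ((1 / q) ^ Y.card * (K * (L * t) / S') ^ β) :=
            mul_le_mul h1 hih measureReal_nonneg hq0.le
        _ = (q * L ^ β) * ((1 / q) ^ Y.card * (K * t / S') ^ β) := by rw [hpow]; ring
        _ = (1 / q) ^ Y.card * (K * t / S') ^ β := by rw [hqL, one_mul]
    · -- BAD first scale: drop it and erase its window centre
      push Not at hbad
      obtain ⟨x, hxX, hx1, hx2⟩ := hbad
      have hxY : x ∈ Y := hY 0 (Nat.succ_pos n) x hxX (by rw [pow_zero, one_mul]; exact hx1)
        (by rw [pow_zero, one_mul]; exact hx2)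
      have hY' : ∀ k < n, ∀ x' ∈ X, x' / K < L ^ k * (L * t) → L ^ k * (L * t) < K * x' →
          x' ∈ Y.erase x := by
        intro k hk x' hx' h1 h2
        rw [Finset.mem_erase]
        refine ⟨?_, hY (k + 1) (by omega) x' hx' (by rw [hLk]; exact h1) (by rw [hLk]; exact h2)⟩
        rintro rfl
        -- one window cannot contain two scales of ratio `≥ L > K²`
        have h3 : x' < t * K := by rwa [div_lt_iff₀ hK0] at hx1
        have h4 : 1 ≤ L ^ k := one_le_pow₀ hL1
        have h5 : L * t ≤ L ^ k * (L * t) := le_mul_of_one_le_left (by positivity) h4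
        have h6 : K * x' < K * (t * K) := mul_lt_mul_of_pos_left h3 hK0
        nlinarith
      have hih := ih (L * t) (Y.erase x) hLt hY' hn'
      have hcard : (Y.erase x).card + 1 = Y.card := by
        rw [Finset.card_erase_of_mem hxY]
        have := Finset.card_pos.2 ⟨x, hxY⟩
        omega
      have hmono : ufrsStrands E w m 2 t S ⊆ ufrsStrands E w m 2 (L * t) S :=
        ufrsStrands_mono_radii htL le_rfl
      calc (bondPercolation (zdGraph 2) half).real (ufrsStrands E w m 2 t S)
          ≤ (bondPercolation (zdGraph 2) half).real (ufrsStrands E w m 2 (L * t) S) :=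
            measureReal_mono hmono (measure_ne_top _ _)
        _ ≤ (1 / q) ^ (Y.erase x).card * (K * (L * t) / S') ^ β := hih
        _ = (1 / q) ^ Y.card * (K * t / S') ^ β := by
            rw [hpow, hLβ, ← hcard, pow_succ]; ring

/-! ## HJ from the per-scale bound -/

/-- **The junction two-strand decay on rectangles from the per-scale junction bound** (registered
sub-goal `ufrs_rect_junctionTwoStrandDecay_of_scale` of stmt-CriticalPhenomena-11387): the
per-scale bound `ufrs_junction_scale_le` (the hypothesis: outside at most `N₀` scale windows
`(x/K, Kx)`, `P_{1/2}(ufrsStrands E w m 2 r (K r)) ≤ 1 - c` for `Mη ≤ r ≤ R₀/K`) implies the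
bridge HJ `ufrs_rect_junctionTwoStrandDecay` VERBATIM, with `β = log_{2K²}(1/q)`,
`q = 1 - min c ½`, and `C = q^{-N₀} (K M/θ)^β`, `θ = min 1 (R₀/((x₁-x₀)+(y₁-y₀)+1))`.
Proof: dyadic product over the scales `(2K²)^k M s` (`junction_scalesInduction_HJ`), empty event
beyond the diameter (`ufrsStrands_eq_empty_of_far_HJ`). -/
theorem ufrs_rect_junctionTwoStrandDecay_of_scale : (∀ (D : DobrushinDomain), (∃ x₀ x₁ y₀ y₁ : ℝ, x₀ < x₁ ∧ y₀ < y₁ ∧ D.carrier = Set.Ioo x₀ x₁ ×ℂ Set.Ioo y₀ y₁) → ∃ (c K M R₀ : ℝ) (N₀ : ℕ), 0 < c ∧ 2 ≤ K ∧ 1 ≤ M ∧ 0 < R₀ ∧ ∃ η₀ > (0:ℝ), ∀ η : ℝ, 0 < η → η < η₀ → ∃ δ₀ > (0:ℝ), ∀ E : DiscreteDobrushin, E.Ω = D.carrier → E.IsZdAdmissible → E.δ < δ₀ → ∀ w : Site 2, ‖meshPoint E.δ w‖ < η → ∀ e₀ : Sym2 (Site 2), (e₀ ∈ E.zdABEdges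 ∨ e₀ ∈ (shiftData E w).zdABEdges) → ∃ X : Finset ℝ, X.card ≤ N₀ ∧ ∀ r : ℝ, M * η ≤ r → K * r ≤ R₀ → (∀ x ∈ X, r ≤ x / K ∨ K * x ≤ r) → (bondPercolation (zdGraph 2) half).real (ufrsStrands E w (medialPoint E.δ e₀) 2 r (K * r)) ≤ 1 - c) → ∀ (D : DobrushinDomain), (∃ x₀ x₁ y₀ y₁ : ℝ, x₀ < x₁ ∧ y₀ < y₁ ∧ D.carrier = Set.Ioo x₀ x₁ ×ℂ Set.Ioo y₀ y₁) → ∃ C β : ℝ, 0 < C ∧ 0 < β ∧ ∃ η₀ > (0:ℝ), ∀ η : ℝ, 0 < η → η < η₀ → ∃ δ₀ > (0:ℝ), ∀ E : DiscreteDobrushin, E.Ω = D.carrier → E.IsZdAdmissible → E.δ < δ₀ → ∀ w : Site 2, ‖meshPoint E.δ w‖ < η → ∀ e₀ : Sym2 (Site 2), (e₀ ∈ E.zdABEdges ∨ e₀ ∈ (shiftData E w).zdABEdges) → ∀ s S : ℝ, η ≤ s → 0 < S → (bondPercolation (zdGraph 2) half).real (ufrsStrands E w (medialPoint E.δ e₀)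 2 s S) ≤ C * (s / S) ^ β := by
  intro hHJS D hD
  obtain ⟨c, K, M, R₀, N₀, hc, hK, hM, hR₀, η₁, hη₁, hSη⟩ := hHJS D hD
  obtain ⟨x₀, x₁, y₀, y₁, hx, hy, hcarrier⟩ := hD
  -- constants (opaque names with defining equations)
  obtain ⟨q, hq⟩ : ∃ q : ℝ, q = 1 - min c (1 / 2) := ⟨_, rfl⟩
  have hc'1 : min c (1 / 2) ≤ 1 / 2 := min_le_right _ _
  have hc'c : min c (1 / 2) ≤ c := min_le_left _ _
  have hq0 : 0 < q := by rw [hq]; linarith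
  have hq1 : q < 1 := by rw [hq]; linarith [lt_min hc (by norm_num : (0:ℝ) < 1 / 2)]
  have hq1' : 1 ≤ 1 / q := by rw [le_div_iff₀ hq0]; linarith
  have hK0 : 0 < K := by linarith
  have hM0 : 0 < M := by linarith
  obtain ⟨L, hL⟩ : ∃ L : ℝ, L = 2 * K ^ 2 := ⟨_, rfl⟩
  have hL1 : 1 < L := by rw [hL]; nlinarith
  have hLK : K ^ 2 < L := by rw [hL]; nlinarith
  have hLK' : K + 4 ≤ L := by rw [hL]; nlinarith
  obtain ⟨β, hβ⟩ : ∃ β : ℝ, β = Real.logb L (1 / q) := ⟨_, rfl⟩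
  have hβ0 : 0 < β := by rw [hβ]; exact Real.logb_pos hL1 (by rw [lt_div_iff₀ hq0]; linarith)
  have hLβ : L ^ β = 1 / q := by rw [hβ]; exact Real.rpow_logb (by linarith) hL1.ne' (by positivity)
  obtain ⟨MD, hMD⟩ : ∃ MD : ℝ, MD = (x₁ - x₀) + (y₁ - y₀) + 1 := ⟨_, rfl⟩
  have hMD0 : 0 < MD := by rw [hMD]; linarith
  obtain ⟨θ, hθ⟩ : ∃ θ : ℝ, θ = min 1 (R₀ / MD) := ⟨_, rfl⟩
  have hθ0 : 0 < θ := hθ ▸ lt_min one_pos (by positivity)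
  have hθ2 : θ ≤ R₀ / MD := hθ ▸ min_le_right _ _
  -- the constants of HJ
  refine ⟨(1 / q) ^ N₀ * (K * M / θ) ^ β, β, by positivity, hβ0, min η₁ (1 / 4),
    lt_min hη₁ (by norm_num), ?_⟩
  intro η hη hηlt
  have hηη₁ : η < η₁ := lt_of_lt_of_le hηlt (min_le_left _ _)
  have hη4 : η < 1 / 4 := lt_of_lt_of_le hηlt (min_le_right _ _)
  obtain ⟨δ₁, hδ₁, hSδ⟩ := hSη η hη hηη₁
  refine ⟨min δ₁ η, lt_min hδ₁ hη, ?_⟩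
  intro E hEΩ hE hδ w hw e₀ he₀ s S hηs hS0
  have hδδ₁ : E.δ < δ₁ := lt_of_lt_of_le hδ (min_le_left _ _)
  have hδη : E.δ < η := lt_of_lt_of_le hδ (min_le_right _ _)
  have hδpos : 0 < E.δ := hE.delta_pos
  obtain ⟨X, hXcard, hscale⟩ := hSδ E hEΩ hE hδδ₁ w hw e₀ he₀
  have hs0 : 0 < s := lt_of_lt_of_le hη hηs
  have hC0 : 0 ≤ (1 / q) ^ N₀ * (K * M / θ) ^ β * (s / S) ^ β := by positivity
  -- far regime: the event is empty
  by_cases hfar : MD < S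
  · have hempty : ufrsStrands E w (medialPoint E.δ e₀) 2 s S = ∅ := by
      refine ufrsStrands_eq_empty_of_far_HJ (hEΩ.trans hcarrier) hη.le hw.le he₀ two_pos s ?_
      linarith
    rw [hempty, measureReal_empty]
    exact hC0
  rw [not_lt] at hfar
  -- the effective outer radius `S' = min S R₀ ≥ θ S`
  obtain ⟨S', hS'⟩ : ∃ S' : ℝ, S' = min S R₀ := ⟨_, rfl⟩
  have hS'0 : 0 < S' := hS' ▸ lt_min hS0 hR₀
  have hS'S : S' ≤ S := hS' ▸ min_le_left _ _
  have hS'R : S' ≤ R₀ := hS' ▸ min_le_right _ _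
  have hθS : θ * S ≤ S' := by
    rw [hS']
    refine le_min (mul_le_of_le_one_left hS0.le (hθ ▸ min_le_left _ _)) ?_
    calc θ * S ≤ R₀ / MD * MD := mul_le_mul hθ2 hfar hS0.le (by positivity)
      _ = R₀ := by field_simp
  -- the per-scale bound in usable form
  have hgood : ∀ r : ℝ, M * η ≤ r → K * r ≤ R₀ → (∀ x ∈ X, r ≤ x / K ∨ K * x ≤ r) →
      (bondPercolation (zdGraph 2) half).real (ufrsStrands E w (medialPoint E.δ e₀) 2 r (K * r)) ≤ q :=
    fun r h1 h2 h3 => (hscale r h1 h2 h3).trans (by rw [hq]; linarith)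
  have hMη : 0 < M * η := mul_pos hM0 hη
  have hδMη : E.δ < M * η := hδη.trans_le (le_mul_of_one_le_left hη.le hM)
  have key := junction_scalesInduction_HJ (S := S) hδpos hK0 hLK hLK' hq0 hq1' hLβ hβ0.le hS'0 hS'S hS'R
    hMη hδMη hgood
  -- apply `key` with `t := M s`, `Y := X` and enough scales
  have hMs : M * η ≤ M * s := mul_le_mul_of_nonneg_left hηs hM0.le
  obtain ⟨n, hn⟩ := pow_unbounded_of_one_lt (S' / (K * (M * s))) hL1
  have hn' : S' ≤ L ^ n * (K * (M * s)) := by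
    have hpos : 0 < K * (M * s) := by positivity
    rw [div_lt_iff₀ hpos] at hn
    linarith
  have hkey := key n (M * s) X hMs (fun k _ x hx _ _ => hx) hn'
  have hmono : ufrsStrands E w (medialPoint E.δ e₀) 2 s S ⊆ ufrsStrands E w (medialPoint E.δ e₀) 2 (M * s) S :=
    ufrsStrands_mono_radii (le_mul_of_one_le_left hs0.le hM) le_rfl
  -- compare the bounds
  have h1 : (1 / q) ^ X.card ≤ (1 / q) ^ N₀ := pow_le_pow_right₀ hq1' hXcard
  have h2' : K * (M * s) / S' ≤ K * M / θ * (s / S) := by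
    calc K * (M * s) / S' ≤ K * (M * s) / (θ * S) :=
          div_le_div_of_nonneg_left (by positivity) (by positivity) hθS
      _ = K * M / θ * (s / S) := by rw [div_mul_div_comm]; ring
  have h2 : (K * (M * s) / S') ^ β ≤ (K * M / θ) ^ β * (s / S) ^ β := by
    rw [← Real.mul_rpow (by positivity) (by positivity)]
    exact Real.rpow_le_rpow (by positivity) h2' hβ0.le
  calc (bondPercolation (zdGraph 2) half).real (ufrsStrands E w (medialPoint E.δ e₀) 2 s S)
      ≤ (bondPercolation (zdGraph 2) half).real (ufrsStrands E w (medialPoint E.δ e₀) 2 (M * s) S) :=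
        measureReal_mono hmono (measure_ne_top _ _)
    _ ≤ (1 / q) ^ X.card * (K * (M * s) / S') ^ β := hkey
    _ ≤ (1 / q) ^ N₀ * ((K * M / θ) ^ β * (s / S) ^ β) :=
        mul_le_mul h1 h2 (by positivity) (by positivity)
    _ = (1 / q) ^ N₀ * (K * M / θ) ^ β * (s / S) ^ β := by ring

end

end Summit.CriticalPhenomena.CardyFormulaZ2.Cruxes.EdgePrecompact.QkzStripBoundaryArm
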